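import Summits.AtomisticToContinuum.BoseEinsteinCondensation.Theorems.BECConjugateDominationHardCoreExtensionPairShellMassTransfer
import Literature.MathematicalPhysics.QuantumManyBody.PeriodicClusteringFromKyFanGap
import HarnessLib

/-!
# (α'₂) Q6 — overlap of two cut states
# (line `third-law-current-floor`, crux `HardCoreExtension`, stmt-AtomisticToContinuum-11786, lead c1, wave 4)

For a real continuous cut-off `0 ≤ χ ≤ 1` with `χ = 1` wherever all image pair distances
`‖xᵢ - xⱼ - Ln‖` are `≥ a + ℓ`, and an `L²(cell)`-orthogonal pair of periodic trial states `Ψ₁, Ψ₂`,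
the overlap of the cut states is controlled by the masses of `Ψ₁, Ψ₂` on the closed core
`{some image pair distance ≤ a}` and on the open outer shell `{some image pair distance ∈ (a, a + ℓ)}`:
`|⟨χΨ₁, χΨ₂⟩_cell| ≤ ½ ∑ᵢ (core mass of Ψᵢ + shell mass of Ψᵢ)`.

Proof: `∫ χ² conj(Ψ₁)Ψ₂ = ∫ conj(Ψ₁)Ψ₂ - ∫ (1 - χ²) conj(Ψ₁)Ψ₂ = -∫ (1 - χ²) conj(Ψ₁)Ψ₂`,
`0 ≤ 1 - χ² ≤ 1_{core ∪ shell}` and `|conj(z₁) z₂| ≤ (|z₁|² + |z₂|²)/2`, then a union bound; the pair sets are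
measurable by `PairShellMass.measurableSet_pairSet`. [folklore]
-/

noncomputable section

namespace Summit.AtomisticToContinuum.BoseEinsteinCondensation.Cruxes.HardCoreExtension.ThirdLawCurrentFloor

open MeasureTheory Filter
open scoped ENNReal NNReal BigOperators Topology ComplexConjugate
open Literature.MathematicalPhysics.QuantumManyBody.BoseGas

namespace CutStatesOverlap

variable {N : ℕ} {L : ℝ}

/-! ### Pointwise algebra -/

/-- `conj(χ z₁) (χ z₂) = conj(z₁) z₂ - (1 - χ²) conj(z₁) z₂` for real `χ`. [folklore] -/
theorem conj_mul_mul_mul_eq (t : ℝ) (z₁ z₂ : ℂ) :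
    conj ((t : ℂ) * z₁) * ((t : ℂ) * z₂) =
      conj z₁ * z₂ - ((1 - t ^ 2 : ℝ) : ℂ) * (conj z₁ * z₂) := by
  rw [map_mul, Complex.conj_ofReal]
  push_cast
  ring

/-- For `0 ≤ t ≤ 1`: `‖(1 - t²) conj(z₁) z₂‖ ≤ (‖z₁‖² + ‖z₂‖²) / 2`. [folklore] -/
theorem norm_one_sub_sq_mul_le {t : ℝ} (h0 : 0 ≤ t) (h1 : t ≤ 1) (z₁ z₂ : ℂ) :
    ‖((1 - t ^ 2 : ℝ) : ℂ) * (conj z₁ * z₂)‖ ≤ (‖z₁‖ ^ 2 + ‖z₂‖ ^ 2) / 2 := by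
  rw [norm_mul, norm_mul, Complex.norm_real, Complex.norm_conj, Real.norm_eq_abs]
  have hs0 : 0 ≤ 1 - t ^ 2 := by nlinarith
  have hs1 : 1 - t ^ 2 ≤ 1 := by nlinarith
  rw [abs_of_nonneg hs0]
  have hp : 0 ≤ ‖z₁‖ * ‖z₂‖ := by positivity
  have hamgm : ‖z₁‖ * ‖z₂‖ ≤ (‖z₁‖ ^ 2 + ‖z₂‖ ^ 2) / 2 := by
    nlinarith [sq_nonneg (‖z₁‖ - ‖z₂‖)]
  calc (1 - t ^ 2) * (‖z₁‖ * ‖z₂‖) ≤ 1 * (‖z₁‖ * ‖z₂‖) := by gcongr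
    _ ≤ _ := by rw [one_mul]; exact hamgm

/-! ### Integration on the cell -/

/-- `∫_s ‖F‖² = (∫⁻_s ‖F‖₊²).toReal` for continuous `F`. [folklore] -/
theorem setIntegral_norm_sq_eq_toReal (s : Set (Config N)) {F : Config N → ℂ} (hF : Continuous F) :
    ∫ X in s, ‖F X‖ ^ 2 = (∫⁻ X in s, ((‖F X‖₊ : ℝ≥0∞)) ^ 2).toReal := by
  rw [integral_eq_lintegral_of_nonneg_ae (f := fun X => ‖F X‖ ^ 2)
    (Eventually.of_forall fun X => by positivity) ((hF.norm.pow 2).aestronglyMeasurable)]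
  congr 1
  refine lintegral_congr fun X => ?_
  rw [← ENNReal.coe_pow, ENNReal.ofReal, Real.toNNReal_pow (norm_nonneg _), norm_toNNReal]

/-- The mass of a trial state on a part of the cell is at most `1`. [folklore] -/
theorem lintegral_inter_cellN_le_one (Ψ : PeriodicTrialState N L) (s : Set (Config N)) :
    ∫⁻ X in s ∩ cellN N L, ((‖Ψ.ψ X‖₊ : ℝ≥0∞)) ^ 2 ≤ 1 := by
  rw [← Ψ.norm_eq]
  exact lintegral_mono_set Set.inter_subset_right

/-- **The cut overlap on one measurable set.** If `0 ≤ χ ≤ 1` is continuous with `χ = 1` off the measurable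
set `D`, then for an `L²(cell)`-orthogonal pair of trial states
`|⟨χΨ₁, χΨ₂⟩_cell| ≤ ½ (∫_{D ∩ cell} |Ψ₁|² + ∫_{D ∩ cell} |Ψ₂|²)`. [folklore] -/
theorem norm_integral_cut_le (χ : Config N → ℝ) (hχc : Continuous χ)
    (hχ01 : ∀ X, 0 ≤ χ X ∧ χ X ≤ 1) {D : Set (Config N)} (hD : MeasurableSet D)
    (hχD : ∀ X, X ∉ D → χ X = 1) (Ψ₁ Ψ₂ : PeriodicTrialState N L)
    (horth : ∫ X in cellN N L, conj (Ψ₁.ψ X) * Ψ₂.ψ X = 0) :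
    ‖∫ X in cellN N L, conj ((χ X : ℂ) * Ψ₁.ψ X) * ((χ X : ℂ) * Ψ₂.ψ X)‖ ≤
      ((∫⁻ X in D ∩ cellN N L, ((‖Ψ₁.ψ X‖₊ : ℝ≥0∞)) ^ 2).toReal +
        (∫⁻ X in D ∩ cellN N L, ((‖Ψ₂.ψ X‖₊ : ℝ≥0∞)) ^ 2).toReal) / 2 := by
  have h1c : Continuous Ψ₁.ψ := Ψ₁.contDiff.continuous
  have h2c : Continuous Ψ₂.ψ := Ψ₂.contDiff.continuous
  -- integrability of `g = conj(Ψ₁)Ψ₂` and of `h = (1 - χ²) g`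
  have hgc : Continuous fun X => conj (Ψ₁.ψ X) * Ψ₂.ψ X := h1c.star.mul h2c
  have hhc : Continuous fun X => ((1 - χ X ^ 2 : ℝ) : ℂ) * (conj (Ψ₁.ψ X) * Ψ₂.ψ X) :=
    (Complex.continuous_ofReal.comp (continuous_const.sub (hχc.pow 2))).mul hgc
  have hgi : IntegrableOn (fun X => conj (Ψ₁.ψ X) * Ψ₂.ψ X) (cellN N L) := integrableOn_cellN hgc L
  have hhi : IntegrableOn (fun X => ((1 - χ X ^ 2 : ℝ) : ℂ) * (conj (Ψ₁.ψ X) * Ψ₂.ψ X))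
      (cellN N L) := integrableOn_cellN hhc L
  -- Step 1: `∫ χ² g = ∫ g - ∫ h = -∫ h`
  have hI : ∫ X in cellN N L, conj ((χ X : ℂ) * Ψ₁.ψ X) * ((χ X : ℂ) * Ψ₂.ψ X) =
      -∫ X in cellN N L, ((1 - χ X ^ 2 : ℝ) : ℂ) * (conj (Ψ₁.ψ X) * Ψ₂.ψ X) := by
    simp_rw [conj_mul_mul_mul_eq]
    rw [integral_sub hgi hhi, horth, zero_sub]
  -- Step 2: the pointwise bound `‖h‖ ≤ 1_D (|Ψ₁|² + |Ψ₂|²)/2`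
  have hptw : ∀ X, ‖((1 - χ X ^ 2 : ℝ) : ℂ) * (conj (Ψ₁.ψ X) * Ψ₂.ψ X)‖ ≤
      D.indicator (fun X => (‖Ψ₁.ψ X‖ ^ 2 + ‖Ψ₂.ψ X‖ ^ 2) / 2) X := by
    intro X
    by_cases hX : X ∈ D
    · rw [Set.indicator_of_mem hX]
      exact norm_one_sub_sq_mul_le (hχ01 X).1 (hχ01 X).2 _ _
    · rw [Set.indicator_of_notMem hX, hχD X hX]
      simp
  -- Step 3: integrate the pointwise bound over the cell
  have hFc : Continuous fun X => (‖Ψ₁.ψ X‖ ^ 2 + ‖Ψ₂.ψ X‖ ^ 2) / 2 :=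
    ((h1c.norm.pow 2).add (h2c.norm.pow 2)).div_const 2
  have hmono : ∫ X in cellN N L, ‖((1 - χ X ^ 2 : ℝ) : ℂ) * (conj (Ψ₁.ψ X) * Ψ₂.ψ X)‖ ≤
      ∫ X in cellN N L, D.indicator (fun X => (‖Ψ₁.ψ X‖ ^ 2 + ‖Ψ₂.ψ X‖ ^ 2) / 2) X :=
    integral_mono hhi.norm ((integrableOn_cellN hFc L).indicator hD) hptw
  have hind : ∫ X in cellN N L, D.indicator (fun X => (‖Ψ₁.ψ X‖ ^ 2 + ‖Ψ₂.ψ X‖ ^ 2) / 2) X =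
      ∫ X in D ∩ cellN N L, (‖Ψ₁.ψ X‖ ^ 2 + ‖Ψ₂.ψ X‖ ^ 2) / 2 := by
    rw [integral_indicator hD, Measure.restrict_restrict hD]
  have hsplit : ∫ X in D ∩ cellN N L, (‖Ψ₁.ψ X‖ ^ 2 + ‖Ψ₂.ψ X‖ ^ 2) / 2 =
      ((∫⁻ X in D ∩ cellN N L, ((‖Ψ₁.ψ X‖₊ : ℝ≥0∞)) ^ 2).toReal +
        (∫⁻ X in D ∩ cellN N L, ((‖Ψ₂.ψ X‖₊ : ℝ≥0∞)) ^ 2).toReal) / 2 := by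
    have hi1 : IntegrableOn (fun X => ‖Ψ₁.ψ X‖ ^ 2) (D ∩ cellN N L) :=
      (integrableOn_cellN (h1c.norm.pow 2) L).mono_set Set.inter_subset_right
    have hi2 : IntegrableOn (fun X => ‖Ψ₂.ψ X‖ ^ 2) (D ∩ cellN N L) :=
      (integrableOn_cellN (h2c.norm.pow 2) L).mono_set Set.inter_subset_right
    rw [integral_div, integral_add hi1 hi2, setIntegral_norm_sq_eq_toReal _ h1c,
      setIntegral_norm_sq_eq_toReal _ h2c]
  calc ‖∫ X in cellN N L, conj ((χ X : ℂ) * Ψ₁.ψ X) * ((χ X : ℂ) * Ψ₂.ψ X)‖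
      = ‖∫ X in cellN N L, ((1 - χ X ^ 2 : ℝ) : ℂ) * (conj (Ψ₁.ψ X) * Ψ₂.ψ X)‖ := by
        rw [hI, norm_neg]
    _ ≤ ∫ X in cellN N L, ‖((1 - χ X ^ 2 : ℝ) : ℂ) * (conj (Ψ₁.ψ X) * Ψ₂.ψ X)‖ :=
        norm_integral_le_integral_norm _
    _ ≤ _ := hmono
    _ = _ := by rw [hind, hsplit]

/-- **The cut overlap, core/shell form.** As `norm_integral_cut_le` with `D = K ∪ O` and the union bound,
delivered as `toReal` of the sum of the four masses. [folklore] -/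
theorem norm_integral_cut_le_union (χ : Config N → ℝ) (hχc : Continuous χ)
    (hχ01 : ∀ X, 0 ≤ χ X ∧ χ X ≤ 1) {K O : Set (Config N)} (hK : MeasurableSet K) (hO : MeasurableSet O)
    (hχKO : ∀ X, X ∉ K → X ∉ O → χ X = 1) (Ψ₁ Ψ₂ : PeriodicTrialState N L)
    (horth : ∫ X in cellN N L, conj (Ψ₁.ψ X) * Ψ₂.ψ X = 0) :
    ‖∫ X in cellN N L, conj ((χ X : ℂ) * Ψ₁.ψ X) * ((χ X : ℂ) * Ψ₂.ψ X)‖ ≤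
      ((∫⁻ X in K ∩ cellN N L, ((‖Ψ₁.ψ X‖₊ : ℝ≥0∞)) ^ 2) +
        (∫⁻ X in O ∩ cellN N L, ((‖Ψ₁.ψ X‖₊ : ℝ≥0∞)) ^ 2) +
        (∫⁻ X in K ∩ cellN N L, ((‖Ψ₂.ψ X‖₊ : ℝ≥0∞)) ^ 2) +
        (∫⁻ X in O ∩ cellN N L, ((‖Ψ₂.ψ X‖₊ : ℝ≥0∞)) ^ 2)).toReal / 2 := by
  have hD : MeasurableSet (K ∪ O) := hK.union hO
  have hχD : ∀ X, X ∉ K ∪ O → χ X = 1 := fun X hX =>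
    hχKO X (fun h => hX (Or.inl h)) (fun h => hX (Or.inr h))
  have key := norm_integral_cut_le χ hχc hχ01 hD hχD Ψ₁ Ψ₂ horth
  -- union bound and finiteness of the masses
  have hU : ∀ Ψ : PeriodicTrialState N L,
      ∫⁻ X in (K ∪ O) ∩ cellN N L, ((‖Ψ.ψ X‖₊ : ℝ≥0∞)) ^ 2 ≤
        (∫⁻ X in K ∩ cellN N L, ((‖Ψ.ψ X‖₊ : ℝ≥0∞)) ^ 2) +
          ∫⁻ X in O ∩ cellN N L, ((‖Ψ.ψ X‖₊ : ℝ≥0∞)) ^ 2 := by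
    intro Ψ
    rw [Set.union_inter_distrib_right]
    exact lintegral_union_le _ _ _
  have hfin : ∀ (Ψ : PeriodicTrialState N L),
      (∫⁻ X in K ∩ cellN N L, ((‖Ψ.ψ X‖₊ : ℝ≥0∞)) ^ 2) +
          ∫⁻ X in O ∩ cellN N L, ((‖Ψ.ψ X‖₊ : ℝ≥0∞)) ^ 2 ≠ ⊤ := fun Ψ =>
    ENNReal.add_ne_top.2 ⟨ne_top_of_le_ne_top ENNReal.one_ne_top (lintegral_inter_cellN_le_one Ψ K),
      ne_top_of_le_ne_top ENNReal.one_ne_top (lintegral_inter_cellN_le_one Ψ O)⟩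
  calc ‖∫ X in cellN N L, conj ((χ X : ℂ) * Ψ₁.ψ X) * ((χ X : ℂ) * Ψ₂.ψ X)‖
      ≤ _ := key
    _ ≤ (((∫⁻ X in K ∩ cellN N L, ((‖Ψ₁.ψ X‖₊ : ℝ≥0∞)) ^ 2) +
            ∫⁻ X in O ∩ cellN N L, ((‖Ψ₁.ψ X‖₊ : ℝ≥0∞)) ^ 2).toReal +
          ((∫⁻ X in K ∩ cellN N L, ((‖Ψ₂.ψ X‖₊ : ℝ≥0∞)) ^ 2) +
            ∫⁻ X in O ∩ cellN N L, ((‖Ψ₂.ψ X‖₊ : ℝ≥0∞)) ^ 2).toReal) / 2 := by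
        have h1 := ENNReal.toReal_mono (hfin Ψ₁) (hU Ψ₁)
        have h2 := ENNReal.toReal_mono (hfin Ψ₂) (hU Ψ₂)
        linarith
    _ = _ := by rw [← ENNReal.toReal_add (hfin Ψ₁) (hfin Ψ₂), ← add_assoc]

end CutStatesOverlap

open CutStatesOverlap

/-- **Q6 `stub_cutStatesOverlap`** (overlap of two cut states). For `0 ≤ χ ≤ 1` continuous with `χ = 1` wherever all
image pair distances are `≥ a + ℓ`, and an `L²(cell)`-orthogonal pair of trial states:
`|⟨χΨ₁, χΨ₂⟩_cell| ≤ ½ ∑ᵢ (mass of Ψᵢ on the closed core `≤ a` + mass of Ψᵢ on the open outer shell `(a, a+ℓ)`)`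
(`∫ χ² conj(Ψ₁)Ψ₂ = ∫ (χ² - 1) conj(Ψ₁)Ψ₂`, `1 - χ² ≤ 1_{core ∪ shell}`, `|ab| ≤ (|a|² + |b|²)/2`). [folklore] -/
theorem stub_cutStatesOverlap :
    ∀ (N : ℕ) (L a ℓ : ℝ) (χ : Config N → ℝ), Continuous χ → (∀ X, 0 ≤ χ X ∧ χ X ≤ 1) →
      (∀ X : Config N, (∀ i j : Fin N, i ≠ j → ∀ n : Fin 3 → ℤ, a + ℓ ≤ ‖X i - X j - latticeVec L n‖) →
        χ X = 1) →
      ∀ Ψ₁ Ψ₂ : PeriodicTrialState N L, (∫ X in cellN N L, conj (Ψ₁.ψ X) * Ψ₂.ψ X = 0) →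
        ‖∫ X in cellN N L, conj ((χ X : ℂ) * Ψ₁.ψ X) * ((χ X : ℂ) * Ψ₂.ψ X)‖ ≤
          ((∫⁻ X in {X : Config N | ∃ i j : Fin N, i ≠ j ∧ ∃ n : Fin 3 → ℤ,
                ‖X i - X j - latticeVec L n‖ ≤ a} ∩ cellN N L, ((‖Ψ₁.ψ X‖₊ : ℝ≥0∞)) ^ 2) +
            (∫⁻ X in {X : Config N | ∃ i j : Fin N, i ≠ j ∧ ∃ n : Fin 3 → ℤ,
                a < ‖X i - X j - latticeVec L n‖ ∧ ‖X i - X j - latticeVec L n‖ < a + ℓ} ∩ cellN N L,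
                ((‖Ψ₁.ψ X‖₊ : ℝ≥0∞)) ^ 2) +
            (∫⁻ X in {X : Config N | ∃ i j : Fin N, i ≠ j ∧ ∃ n : Fin 3 → ℤ,
                ‖X i - X j - latticeVec L n‖ ≤ a} ∩ cellN N L, ((‖Ψ₂.ψ X‖₊ : ℝ≥0∞)) ^ 2) +
            (∫⁻ X in {X : Config N | ∃ i j : Fin N, i ≠ j ∧ ∃ n : Fin 3 → ℤ,
                a < ‖X i - X j - latticeVec L n‖ ∧ ‖X i - X j - latticeVec L n‖ < a + ℓ} ∩ cellN N L,
                ((‖Ψ₂.ψ X‖₊ : ℝ≥0∞)) ^ 2)).toReal / 2 := by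
  intro N L a ℓ χ hχc hχ01 hχfar1 Ψ₁ Ψ₂ horth
  have hK : MeasurableSet {X : Config N | ∃ i j : Fin N, i ≠ j ∧ ∃ n : Fin 3 → ℤ,
      ‖X i - X j - latticeVec L n‖ ≤ a} :=
    PairShellMass.measurableSet_pairSet N L (V := {y : Space | ‖y‖ ≤ a})
      (measurableSet_le measurable_norm measurable_const)
  have hO : MeasurableSet {X : Config N | ∃ i j : Fin N, i ≠ j ∧ ∃ n : Fin 3 → ℤ,
      a < ‖X i - X j - latticeVec L n‖ ∧ ‖X i - X j - latticeVec L n‖ < a + ℓ} :=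
    PairShellMass.measurableSet_pairSet N L (V := {y : Space | a < ‖y‖ ∧ ‖y‖ < a + ℓ})
      ((measurableSet_lt measurable_const measurable_norm).inter
        (measurableSet_lt measurable_norm measurable_const))
  refine norm_integral_cut_le_union χ hχc hχ01 hK hO (fun X hXK hXO => hχfar1 X ?_) Ψ₁ Ψ₂ horth
  intro i j hij n
  simp only [Set.mem_setOf_eq, not_exists, not_and, not_lt, not_le] at hXK hXO
  exact hXO i j hij n (hXK i j hij n)

end Summit.AtomisticToContinuum.BoseEinsteinCondensation.Cruxes.HardCoreExtension.ThirdLawCurrentFloor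

end
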